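import Literature.NumberTheory.Automorphic.UnitaryGroupBorelInduction   -- ★ `UnitaryGroup.torusU`, `mem_torusU_iff`, `glDiagonal_mem_unitaryGroupOfForm_antidiagonal_iff`, `StdForm.antidiagonal`
import Literature.NumberTheory.Rogawski1990.LocalTransfer                -- ★ `IsRegularElt` (:228), `isRegularElt_conj_iff`
import Summits.HodgeConjecture.HodgeConjecture.Theorems.F0P3cStCharTSWeylHypFibre   -- ★ p849559 (A0′) `isUnit_sub_of_isRegularElt_glDiagonal` (LH2-p01 (g3))
import HarnessLib

/-!
# F0 · P3c · line LH6 «StCharTS» — «ELL-CRIT★» (E1): THE EIGENVALUE TEST FOR NON-ELLIPTICITY IN `U(σ, Φ₃)(R)` —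
# an element conjugate into the split torus `M` has a rational eigenvalue `α` with `α · σ(α) ≠ 1` [Rogawski1990 §12.5 p. 182; §3.6; §1.10]

Cell `pub/hodgecm-mathlib`, crux H413 = `stmt-HodgeConjecture-24833` (`--supports` lane, helper), route HCCMUnconditional; seat F0P2-p02 (g15),
deal «ELL-CRIT★» of F0P3b-plan (g23) 2026-09-02T05:43:16Z.  THEOREMS ONLY, sorry-free, no definition ∕ instance ∕ notation ∕ named fact.

PURPOSE.  The §12.5 datum of the LH6 leaf `Cruxes/H413/Lines/F0_P3c_StCharTSPaydown.lean` will define its elliptic set against the split torus: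
`ellG := {γ regular | ¬ ∃ g, g γ g⁻¹ ∈ M}` («elliptic regular = regular semisimple lying in no proper `F`-parabolic»; for the rank-one quasi-split
`U(Φ₃)` the only proper parabolic is the Borel `B = MN`, so «not conjugate into `M`»).  This file is the EASY DIRECTION of the eigenvalue criterion:

* §1 (any `N`, any form `J`, any commutative ring `R`): if `g γ g⁻¹ = diag(d) ∈ M = torusU σ J` then every `dᵢ` is a root of the characteristic
  polynomial of `γ` (`isRoot_charpoly_of_glDiagonal_eq_conj`); hence **`not_conj_mem_torusU_of_forall_not_isRoot`**: an element whose characteristic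
  polynomial has NO root in `R` is conjugate into `M` by NO `g ∈ U` — the (T3)-first-half read-back: with ★ `F0P3cStCharTSTypeThreeTorus`
  (`exists_irreducible_charpoly_of_nonsplit`, LH1-p03 (g2)) and ★ `F0P3cStCharTSTypeThreeCentralizer` (`not_isRoot_charpoly_of_mem_centralizer_of_isRegularElt`,
  LH1-p01 (g3)) every regular element of the type-(3) torus is elliptic in the sense of `ellG`.
* §2 (`N = 3`, `J = Φ₃ = (StdForm.antidiagonal 3).over R`, `R` nontrivial): **`exists_isRoot_of_conj_mem_torusU`** — if `g γ g⁻¹ ∈ M` and `γ` is REGULAR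
  (`IsRegularElt`: separable characteristic polynomial) then `∃ α, charpoly(γ).IsRoot α ∧ α · σ(α) ≠ 1`.  Road: `g γ g⁻¹ = diag(d₀, d₁, d₂)` with the torus
  relations `σ(d₂) d₀ = 1`, `σ(d₁) d₁ = 1`, `σ(d₀) d₂ = 1` (★ `glDiagonal_mem_unitaryGroupOfForm_antidiagonal_iff`), so `α := d₀` is a root and `d₀ σ(d₀) = 1`
  would force `d₂ = d₀` (both inverse to `σ(d₀)`), contradicting the unit difference `d₀ − d₂ ∈ Rˣ` of a regular diagonal element (★ (A0′)
  `isUnit_sub_of_isRegularElt_glDiagonal`).  `∃ g`-form: `exists_isRoot_of_exists_conj_mem_torusU`; contrapositive `forall_not_conj_mem_torusU_of_forall_isRoot`.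
NOT HERE (honest census): the CONVERSE (E2) «`γ` regular with a root `α`, `α σ(α) ≠ 1` ⇒ `∃ g, g γ g⁻¹ ∈ M`» (over a field-like `R` with `σ` involutive:
the `σ`-inverse symmetry of the spectrum makes the characteristic polynomial split with roots `α, σ(α)⁻¹, β`, `β σ(β) = 1`, and the eigenbasis is a
hyperbolic-orthogonal frame) is the sequel brick.
HONEST LABEL: HC_CM is proved only modulo the 7 printed citations (2 remaining: hLiu418 = `stmt-HodgeConjecture-24832`, h413 = `stmt-HodgeConjecture-24833`)
until rung 0 closes; this file is count-neutral package-side algebra and closes no organ.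

## References
* [Rogawski1990] J. D. Rogawski, *Automorphic Representations of Unitary Groups in Three Variables*, Ann. of Math. Stud. 123 (1990), §12.5 p. 182
  (elliptic regular set of `U(3)`), §3.6 (elliptic elements, parabolic subgroups), §1.10 p. 9 (`B = MN`, `M = {d(α, β, ᾱ⁻¹)}`), §3.1 p. 19 (regular elements).
* [SpringerLAG1998] T. A. Springer, *Linear Algebra Groups*, 2nd ed. (1998), 8.1.12 (semisimple elements and tori).
-/

set_option autoImplicit false
set_option linter.dupNamespace false

open Matrix Polynomial
open Literature.NumberTheory.Automorphic Literature.NumberTheory.Automorphic.UnitaryGroup Literature.NumberTheory.Rogawski1990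
open Summit.HodgeConjecture.HodgeConjecture.Cruxes.H413.F0P3cStCharTSWeylHypFibre
open scoped MatrixGroups

namespace Summit.HodgeConjecture.HodgeConjecture.Cruxes.H413.F0P3cStCharTSEllipticCriterion

/-! ## §1 Any rank, any form: an element conjugate into the diagonal torus has all the `dᵢ` as eigenvalues -/

section AnyForm

variable {R : Type*} [CommRing R] (σ : R →+* R) {N : ℕ} (J : Matrix (Fin N) (Fin N) R)

/-- The subtype-group conjugate `g γ g⁻¹` read in `GL_N(R)`. [cite: Rogawski1990, §1.10 p. 9] -/
theorem coe_conj (γ g : ↥(unitaryGroupOfForm σ J)) :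
    ((g * γ * g⁻¹ : ↥(unitaryGroupOfForm σ J)) : GL (Fin N) R) = (g : GL (Fin N) R) * (γ : GL (Fin N) R) * (g : GL (Fin N) R)⁻¹ := by
  simp only [Subgroup.coe_mul, InvMemClass.coe_inv]

/-- **Conjugation does not change the characteristic polynomial** (in the subtype group `↥U(σ, J)(R)`). [cite: Rogawski1990, §3.1 p. 19] -/
theorem charpoly_coe_conj (γ g : ↥(unitaryGroupOfForm σ J)) :
    (((g * γ * g⁻¹ : ↥(unitaryGroupOfForm σ J)) : GL (Fin N) R) : Matrix (Fin N) (Fin N) R).charpoly =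
      ((γ : GL (Fin N) R) : Matrix (Fin N) (Fin N) R).charpoly := by
  rw [coe_conj, Units.val_mul, Units.val_mul, Matrix.coe_units_inv, Matrix.charpoly_units_conj]

/-- **Every diagonal entry of a diagonal conjugate is an eigenvalue**: if `diag(d) = g γ g⁻¹` in `GL_N(R)` then `charpoly(γ)(dᵢ) = 0` for every `i`
(`charpoly(γ) = charpoly(g γ g⁻¹) = ∏ₖ (X − dₖ)`). [cite: Rogawski1990, §1.10 p. 9; §3.1 p. 19] -/
theorem isRoot_charpoly_of_glDiagonal_eq_conj {γ g : ↥(unitaryGroupOfForm σ J)} {d : Fin N → Rˣ}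
    (hd : glDiagonal N R d = ((g * γ * g⁻¹ : ↥(unitaryGroupOfForm σ J)) : GL (Fin N) R)) (i : Fin N) :
    ((γ : GL (Fin N) R) : Matrix (Fin N) (Fin N) R).charpoly.IsRoot (d i : R) := by
  rw [← charpoly_coe_conj σ J γ g, ← hd, coe_glDiagonal, Matrix.charpoly_diagonal, Polynomial.IsRoot.def, Polynomial.eval_prod]
  exact Finset.prod_eq_zero (Finset.mem_univ i) (by simp)

/-- **An element conjugate into the diagonal torus `M = torusU σ J` has a rational eigenvalue** (`N ≠ 0`). [cite: Rogawski1990, §1.10 p. 9; §3.6] -/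
theorem exists_isRoot_charpoly_of_conj_mem_torusU [NeZero N] {γ g : ↥(unitaryGroupOfForm σ J)} (h : g * γ * g⁻¹ ∈ torusU σ J) :
    ∃ c : R, ((γ : GL (Fin N) R) : Matrix (Fin N) (Fin N) R).charpoly.IsRoot c := by
  obtain ⟨d, hd⟩ := (mem_torusU_iff (g * γ * g⁻¹)).1 h
  exact ⟨d 0, isRoot_charpoly_of_glDiagonal_eq_conj σ J hd 0⟩

/-- **(T3)-first-half read-back: NO rational eigenvalue ⇒ conjugate into the split torus by NOBODY.**  If the characteristic polynomial of `γ ∈ U(σ, J)(R)` has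
no root in `R` then `g γ g⁻¹ ∉ M = torusU σ J` for every `g ∈ U` — with ★ `exists_irreducible_charpoly_of_nonsplit` ∕ ★ `not_isRoot_charpoly_of_mem_centralizer_of_isRegularElt`:
every regular element of the type-(3) torus of `U(Φ₃)(L⁺_v)` (non-split `v`) lies in `ellG`. [cite: Rogawski1990, §12.5 p. 182; §3.6] -/
theorem not_conj_mem_torusU_of_forall_not_isRoot [NeZero N] {γ : ↥(unitaryGroupOfForm σ J)}
    (h : ∀ c : R, ¬ ((γ : GL (Fin N) R) : Matrix (Fin N) (Fin N) R).charpoly.IsRoot c) (g : ↥(unitaryGroupOfForm σ J)) :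
    g * γ * g⁻¹ ∉ torusU σ J := fun hg => by
  obtain ⟨c, hc⟩ := exists_isRoot_charpoly_of_conj_mem_torusU σ J hg
  exact h c hc

/-- `∃`-free reading of the same fact: `¬ ∃ g, g γ g⁻¹ ∈ M`. [cite: Rogawski1990, §12.5 p. 182; §3.6] -/
theorem not_exists_conj_mem_torusU_of_forall_not_isRoot [NeZero N] {γ : ↥(unitaryGroupOfForm σ J)}
    (h : ∀ c : R, ¬ ((γ : GL (Fin N) R) : Matrix (Fin N) (Fin N) R).charpoly.IsRoot c) :
    ¬ ∃ g : ↥(unitaryGroupOfForm σ J), g * γ * g⁻¹ ∈ torusU σ J := fun ⟨g, hg⟩ =>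
  not_conj_mem_torusU_of_forall_not_isRoot σ J h g hg

/-- Regularity passes to the conjugate `g γ g⁻¹` (subtype-group form of ★ `isRegularElt_conj_iff`). [cite: Rogawski1990, §3.1 p. 19] -/
theorem isRegularElt_coe_conj_iff (γ g : ↥(unitaryGroupOfForm σ J)) :
    IsRegularElt ((g * γ * g⁻¹ : ↥(unitaryGroupOfForm σ J)) : GL (Fin N) R) ↔ IsRegularElt (γ : GL (Fin N) R) := by
  rw [coe_conj, isRegularElt_conj_iff]

end AnyForm

/-! ## §2 `N = 3`, `J = Φ₃`: a REGULAR element conjugate into `M` has an eigenvalue `α` with `α σ(α) ≠ 1` -/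

section AntidiagThree

variable {R : Type*} [CommRing R] (σ : R →+* R)

/-- **The torus relations at `Φ₃`** for a diagonal `diag(d) ∈ U(σ, Φ₃)(R)`: `σ(d₂) d₀ = 1`, `σ(d₁) d₁ = 1`, `σ(d₀) d₂ = 1` (`d = (α, β, σ(α)⁻¹)`).
[cite: Rogawski1990, §1.10 p. 9] -/
theorem torus_relations_of_glDiagonal_eq {J : Matrix (Fin 3) (Fin 3) R} (hJ : J = (StdForm.antidiagonal 3).over R)
    {t : ↥(unitaryGroupOfForm σ J)} {d : Fin 3 → Rˣ} (hd : glDiagonal 3 R d = (t : GL (Fin 3) R)) :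
    σ (d 2 : R) * d 0 = 1 ∧ σ (d 1 : R) * d 1 = 1 ∧ σ (d 0 : R) * d 2 = 1 := by
  have hU : glDiagonal 3 R d ∈ unitaryGroupOfForm σ ((StdForm.antidiagonal 3).over R) := by
    rw [hd, ← hJ]; exact t.2
  have h := (glDiagonal_mem_unitaryGroupOfForm_antidiagonal_iff σ 3 d).1 hU
  exact ⟨h 0, h 1, h 2⟩

/-- **«ELL-CRIT★» (E1).**  In `U = U(σ, Φ₃)(R)` (`R` nontrivial): if `g γ g⁻¹ ∈ M = torusU σ Φ₃` and `γ` is REGULAR then `γ` has an eigenvalue `α ∈ R` with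
`α · σ(α) ≠ 1`.  Proof: `g γ g⁻¹ = diag(d₀, d₁, d₂)`, `α := d₀` is a root of `charpoly(γ)`; the torus relations give `σ(d₀) d₂ = 1`, so `d₀ σ(d₀) = 1` would make
`d₀` and `d₂` two inverses of `σ(d₀)`, i.e. `d₀ = d₂` — but a regular diagonal element has `d₀ − d₂ ∈ Rˣ`. (The converse, for regular `γ` over a field-like
`R`, is brick (E2).) [cite: Rogawski1990, §12.5 p. 182; §3.6; §1.10 p. 9] -/
theorem exists_isRoot_of_conj_mem_torusU [Nontrivial R] {J : Matrix (Fin 3) (Fin 3) R} (hJ : J = (StdForm.antidiagonal 3).over R)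
    {γ g : ↥(unitaryGroupOfForm σ J)} (h : g * γ * g⁻¹ ∈ torusU σ J) (hreg : IsRegularElt (γ : GL (Fin 3) R)) :
    ∃ α : R, ((γ : GL (Fin 3) R) : Matrix (Fin 3) (Fin 3) R).charpoly.IsRoot α ∧ α * σ α ≠ 1 := by
  obtain ⟨d, hd⟩ := (mem_torusU_iff (g * γ * g⁻¹)).1 h
  refine ⟨d 0, isRoot_charpoly_of_glDiagonal_eq_conj σ J hd 0, fun h1 => ?_⟩
  obtain ⟨-, -, h02⟩ := torus_relations_of_glDiagonal_eq σ hJ hd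
  -- `d₀` and `d₂` are both inverse to `σ(d₀)`
  have heq : (d 0 : R) = d 2 := by
    calc (d 0 : R) = d 0 * (σ (d 0 : R) * d 2) := by rw [h02, mul_one]
      _ = (d 0 * σ (d 0 : R)) * d 2 := by rw [mul_assoc]
      _ = d 2 := by rw [h1, one_mul]
  -- but `d₀ − d₂` is a unit for a regular diagonal element
  have hreg' : IsRegularElt (glDiagonal 3 R d) := by
    rw [hd]; exact (isRegularElt_coe_conj_iff σ J γ g).2 hreg
  have hu := isUnit_sub_of_isRegularElt_glDiagonal (i := 0) (j := 2) hreg' (by decide)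
  rw [heq, sub_self] at hu
  exact not_isUnit_zero hu

/-- The same with the SECOND hyperbolic eigenvalue: `α := d₂` also has `α σ(α) ≠ 1` (symmetric statement, recorded for consumers that read the last slot).
[cite: Rogawski1990, §12.5 p. 182; §1.10 p. 9] -/
theorem exists_isRoot_of_conj_mem_torusU' [Nontrivial R] {J : Matrix (Fin 3) (Fin 3) R} (hJ : J = (StdForm.antidiagonal 3).over R)
    {γ g : ↥(unitaryGroupOfForm σ J)} (h : g * γ * g⁻¹ ∈ torusU σ J) (hreg : IsRegularElt (γ : GL (Fin 3) R)) :
    ∃ α : R, ((γ : GL (Fin 3) R) : Matrix (Fin 3) (Fin 3) R).charpoly.IsRoot α ∧ σ α * α ≠ 1 := by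
  obtain ⟨α, hα, hne⟩ := exists_isRoot_of_conj_mem_torusU σ hJ h hreg
  exact ⟨α, hα, by rwa [mul_comm]⟩

/-- **`∃ g`-form of (E1)** (the shape of `ellG := {γ regular | ¬ ∃ g, g γ g⁻¹ ∈ M}`): a regular `γ` conjugate into `M` by SOME `g ∈ U` has an eigenvalue `α`
with `α σ(α) ≠ 1`. [cite: Rogawski1990, §12.5 p. 182; §3.6] -/
theorem exists_isRoot_of_exists_conj_mem_torusU [Nontrivial R] {J : Matrix (Fin 3) (Fin 3) R} (hJ : J = (StdForm.antidiagonal 3).over R)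
    {γ : ↥(unitaryGroupOfForm σ J)} (hreg : IsRegularElt (γ : GL (Fin 3) R))
    (h : ∃ g : ↥(unitaryGroupOfForm σ J), g * γ * g⁻¹ ∈ torusU σ J) :
    ∃ α : R, ((γ : GL (Fin 3) R) : Matrix (Fin 3) (Fin 3) R).charpoly.IsRoot α ∧ α * σ α ≠ 1 := by
  obtain ⟨g, hg⟩ := h
  exact exists_isRoot_of_conj_mem_torusU σ hJ hg hreg

/-- **Contrapositive (the elliptic side of the test)**: a regular `γ ∈ U(σ, Φ₃)(R)` all of whose rational eigenvalues `α` satisfy `α σ(α) = 1` is conjugate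
into `M` by NO `g ∈ U`. [cite: Rogawski1990, §12.5 p. 182; §3.6] -/
theorem forall_not_conj_mem_torusU_of_forall_isRoot [Nontrivial R] {J : Matrix (Fin 3) (Fin 3) R} (hJ : J = (StdForm.antidiagonal 3).over R)
    {γ : ↥(unitaryGroupOfForm σ J)} (hreg : IsRegularElt (γ : GL (Fin 3) R))
    (h : ∀ α : R, ((γ : GL (Fin 3) R) : Matrix (Fin 3) (Fin 3) R).charpoly.IsRoot α → α * σ α = 1) (g : ↥(unitaryGroupOfForm σ J)) :
    g * γ * g⁻¹ ∉ torusU σ J := fun hg => by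
  obtain ⟨α, hα, hne⟩ := exists_isRoot_of_conj_mem_torusU σ hJ hg hreg
  exact hne (h α hα)

/-- **A torus element itself** (`g = 1`): a regular `m ∈ M` has an eigenvalue `α` with `α σ(α) ≠ 1` — in particular no regular element of the SPLIT torus
passes the elliptic test («SPLIT-NOT-ELL» read-back). [cite: Rogawski1990, §12.5 p. 182; §1.10 p. 9] -/
theorem exists_isRoot_of_mem_torusU [Nontrivial R] {J : Matrix (Fin 3) (Fin 3) R} (hJ : J = (StdForm.antidiagonal 3).over R)
    {m : ↥(unitaryGroupOfForm σ J)} (hm : m ∈ torusU σ J) (hreg : IsRegularElt (m : GL (Fin 3) R)) :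
    ∃ α : R, ((m : GL (Fin 3) R) : Matrix (Fin 3) (Fin 3) R).charpoly.IsRoot α ∧ α * σ α ≠ 1 :=
  exists_isRoot_of_conj_mem_torusU σ hJ (g := 1) (by simpa using hm) hreg

end AntidiagThree

end Summit.HodgeConjecture.HodgeConjecture.Cruxes.H413.F0P3cStCharTSEllipticCriterion
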